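import Mathlib
import Summits.ResolutionOfSingularities.ResolutionOfSingularities.Theorems.RadicialJungCleanModelsL7bGlobal
import Summits.ResolutionOfSingularities.ResolutionOfSingularities.Theorems.RadicialJungCleanModelsContactChainL7bX44c
import HarnessLib

/-!
# Route `RadicialJung`, crux `CleanModels` (stmt-ResolutionOfSingularities-15917), line `Sketch` rev 35, stub 6 `stub_cleanProp44` (X44c),
# work plan O8 — L7b-GLOBAL in the currency of `stub_cleanProp44`

✓ `exists_proper_isIso_forall_cleanPermissibleAt` (`…L7bGlobal.lean`) read on a STAGE of X44c, as ✓ p816297 read L7b: `S` a regular excellent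
Noetherian integral scheme with `char K(S) = p`, the line of `G₀` clean-regular at every point of `S`, `ρ : X → S` a clean-permissible
Cossart–Piltant sequence (`IsCleanRegularCentreBlowupSeq p ρ I G₀`) with `X` Noetherian.  Then `X` is regular and quasi-excellent and the line of
`ρ^♯ G₀` is clean-regular at every point of `X` (✓ `IsCleanRegularCentreBlowupSeq.cleanRegAt`), so for every ONE-DIMENSIONAL regular curve
`C₀ = cl{η} ⊆ X` (`dim 𝒪_{X,η} = 2`; points other than `η` closed with `dim 𝒪 = 3`) the bad set is finite
(✓ `finite_setOf_not_cleanPermissibleAt_of_cleanRegAt_genericPoint`) and L7b-global applies: a proper dominant `σ : X' → X`, an isomorphism over every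
open avoiding the bad points, with `X'` regular quasi-excellent and the strict transform `C = cl{η'}` a regular curve at EVERY point of which the
line of `(σ ≫ ρ)^♯ G₀` is clean-permissible — ready for `IsCleanRegularCentreBlowupSeq.cons` once `σ` is recorded as such a sequence (O6).

Honest framing: OURS; item O8/L7b-global of the X44c work plan (memo `Sketch-memo-4e-cleanPermissible.md` §4) in X44c's own hypotheses — nothing
here proves X44c (O1–O7 remain), resolution in characteristic `p`, or any case of `CleanModels`.
-/

noncomputable section

set_option linter.dupNamespace false -- mandated namespace of this single-conjunct summit

open CategoryTheory AlgebraicGeometry TopologicalSpace IsLocalRing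
open Literature.AlgebraicGeometry.Resolution Literature.AlgebraicGeometry.Motives
open Scheme.IdealSheafData

namespace Summit.ResolutionOfSingularities.ResolutionOfSingularities.Theorems.RadicialJung.CleanModels

/-- **L7b-global on the stages of X44c.**  See the module docstring. [cite: CossartPiltant2008, Prop. 4.4 (proof, p. 10)]
[cite: Piltant2013, §2 Axiom 4] [cite: CossartJannsenSaito2020, proof of Thm. 6.28, Step 5] -/
theorem exists_proper_isIso_forall_cleanPermissibleAt_of_isCleanRegularCentreBlowupSeq (p : ℕ) [hp : Fact p.Prime] {S : Scheme.{0}}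
    [IsIntegral S] [IsNoetherian S] [CharP S.functionField p] (hS : Scheme.IsRegular S) (hE : Scheme.IsExcellent S) (G₀ : S.functionField)
    (hG₀ : ∀ s : S, CleanRegAt p (algebraMap (S.presheaf.stalk s) S.functionField) G₀) {I : S.IdealSheafData}
    {X : Scheme.{0}} {ρ : X ⟶ S} [IsIntegral X] [IsNoetherian X] [IsDominant ρ] (hρ : IsCleanRegularCentreBlowupSeq p ρ I G₀)
    {C₀ : Closeds X}
    (hC₀reg : ∀ y ∈ (C₀ : Set X), ∃ c : Fin 2 → X.presheaf.stalk y,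
      IsRsopPart c ∧ Ideal.span (Set.range c) = stalkIdeal (vanishingIdeal C₀) y)
    {η : X} (hη : (C₀ : Set X) = closure {η}) (hdimη : ringKrullDim (X.presheaf.stalk η) = 2)
    (hcl : ∀ y ∈ (C₀ : Set X), y ≠ η → IsClosed ({y} : Set X)) (hdim3 : ∀ y ∈ (C₀ : Set X), y ≠ η → ringKrullDim (X.presheaf.stalk y) = 3) :
    ∃ (X' : Scheme.{0}) (_ : IsIntegral X') (_ : IsLocallyNoetherian X') (σ : X' ⟶ X) (_ : IsDominant σ) (C : Closeds X') (η' : X'),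
      IsProper σ ∧
      (∀ U : X.Opens, (∀ y ∈ (C₀ : Set X), y ∈ U →
          CleanPermissibleAt p (RatFn.toFunctionField y) (RatFn.functionFieldMap ρ G₀) (stalkIdeal (vanishingIdeal C₀) y)) → IsIso (σ ∣_ U)) ∧
      Scheme.IsRegular X' ∧ Scheme.IsQuasiExcellent X' ∧
      (∀ y ∈ (C : Set X'), ∃ c : Fin 2 → X'.presheaf.stalk y, IsRsopPart c ∧ Ideal.span (Set.range c) = stalkIdeal (vanishingIdeal C) y) ∧
      (C : Set X') = closure {η'} ∧ σ η' = η ∧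
      {y : X | y ∈ (C₀ : Set X) ∧
        ¬ CleanPermissibleAt p (RatFn.toFunctionField y) (RatFn.functionFieldMap ρ G₀) (stalkIdeal (vanishingIdeal C₀) y)}.Finite ∧
      ∀ y ∈ (C : Set X'), CleanPermissibleAt p (RatFn.toFunctionField y) (RatFn.functionFieldMap σ (RatFn.functionFieldMap ρ G₀))
        (stalkIdeal (vanishingIdeal C) y) := by
  have hX : Scheme.IsRegular X := hρ.isRegularCentreBlowupSeq.isRegular hS
  have hXE : Scheme.IsQuasiExcellent X := hρ.isRegularCentreBlowupSeq.isQuasiExcellent hE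
  haveI : CharP X.functionField p := charP_of_injective_ringHom (RatFn.functionFieldMap ρ).injective p
  have hclean : ∀ x : X, CleanRegAt p (RatFn.toFunctionField x) (RatFn.functionFieldMap ρ G₀) :=
    fun x => hρ.cleanRegAt hp.out inferInstance hG₀ x
  set G := RatFn.functionFieldMap ρ G₀ with hG
  have hfin := finite_setOf_not_cleanPermissibleAt_of_cleanRegAt_genericPoint hX hXE p hC₀reg hη hdimη hcl G (hclean η)
  have hηgood := cleanPermissibleAt_genericPoint_of_cleanRegAt p hη G (hclean η)
  obtain ⟨X', h1, h2, σ, h3, C, η', hprop, hiso, hX', hE', hCreg, hη', hση', hall⟩ :=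
    exists_proper_isIso_forall_cleanPermissibleAt hX hXE p hC₀reg hη hcl hdim3 G hηgood (fun y _ _ => hclean y) hfin
  exact ⟨X', h1, h2, σ, h3, C, η', hprop, hiso, hX', hE', hCreg, hη', hση', hfin, hall⟩

/-- The new stage is again a NOETHERIAN scheme (proper over the Noetherian `X`), with `char K(X') = p`, regular and quasi-excellent, and the line of
`(σ ≫ ρ)^♯ G₀ = σ^♯ ρ^♯ G₀` clean-permissible at every point of the strict transform: the form in which the next centre of X44c is blown up.
[cite: CossartPiltant2008, Prop. 4.4 (proof, p. 10)] [cite: Piltant2013, §2 Axiom 4] -/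
theorem exists_isNoetherian_forall_cleanPermissibleAt_of_isCleanRegularCentreBlowupSeq (p : ℕ) [hp : Fact p.Prime] {S : Scheme.{0}}
    [IsIntegral S] [IsNoetherian S] [CharP S.functionField p] (hS : Scheme.IsRegular S) (hE : Scheme.IsExcellent S) (G₀ : S.functionField)
    (hG₀ : ∀ s : S, CleanRegAt p (algebraMap (S.presheaf.stalk s) S.functionField) G₀) {I : S.IdealSheafData}
    {X : Scheme.{0}} {ρ : X ⟶ S} [IsIntegral X] [IsNoetherian X] [IsDominant ρ] (hρ : IsCleanRegularCentreBlowupSeq p ρ I G₀)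
    {C₀ : Closeds X}
    (hC₀reg : ∀ y ∈ (C₀ : Set X), ∃ c : Fin 2 → X.presheaf.stalk y,
      IsRsopPart c ∧ Ideal.span (Set.range c) = stalkIdeal (vanishingIdeal C₀) y)
    {η : X} (hη : (C₀ : Set X) = closure {η}) (hdimη : ringKrullDim (X.presheaf.stalk η) = 2)
    (hcl : ∀ y ∈ (C₀ : Set X), y ≠ η → IsClosed ({y} : Set X)) (hdim3 : ∀ y ∈ (C₀ : Set X), y ≠ η → ringKrullDim (X.presheaf.stalk y) = 3) :
    ∃ (X' : Scheme.{0}) (_ : IsIntegral X') (_ : IsNoetherian X') (σ : X' ⟶ X) (_ : IsDominant σ) (C : Closeds X') (η' : X'),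
      IsProper σ ∧ CharP X'.functionField p ∧
      (∀ U : X.Opens, (∀ y ∈ (C₀ : Set X), y ∈ U →
          CleanPermissibleAt p (RatFn.toFunctionField y) (RatFn.functionFieldMap ρ G₀) (stalkIdeal (vanishingIdeal C₀) y)) → IsIso (σ ∣_ U)) ∧
      Scheme.IsRegular X' ∧ Scheme.IsQuasiExcellent X' ∧
      (∀ y ∈ (C : Set X'), ∃ c : Fin 2 → X'.presheaf.stalk y, IsRsopPart c ∧ Ideal.span (Set.range c) = stalkIdeal (vanishingIdeal C) y) ∧
      (C : Set X') = closure {η'} ∧ σ η' = η ∧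
      ∀ y ∈ (C : Set X'), CleanPermissibleAt p (RatFn.toFunctionField y) (RatFn.functionFieldMap (σ ≫ ρ) G₀) (stalkIdeal (vanishingIdeal C) y) := by
  obtain ⟨X', h1, h2, σ, h3, C, η', hprop, hiso, hX', hE', hCreg, hη', hση', -, hall⟩ :=
    exists_proper_isIso_forall_cleanPermissibleAt_of_isCleanRegularCentreBlowupSeq p hS hE G₀ hG₀ hρ hC₀reg hη hdimη hcl hdim3
  haveI := hprop
  haveI : CompactSpace X' := QuasiCompact.compactSpace_of_compactSpace σ
  haveI : IsNoetherian X' := {}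
  haveI : CharP X.functionField p := charP_of_injective_ringHom (RatFn.functionFieldMap ρ).injective p
  have hchar : CharP X'.functionField p := charP_of_injective_ringHom (RatFn.functionFieldMap σ).injective p
  refine ⟨X', h1, inferInstance, σ, h3, C, η', hprop, hchar, hiso, hX', hE', hCreg, hη', hση', fun y hy => ?_⟩
  rw [RatFn.functionFieldMap_comp ρ σ, RingHom.comp_apply]
  exact hall y hy

end Summit.ResolutionOfSingularities.ResolutionOfSingularities.Theorems.RadicialJung.CleanModels

end
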